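import Summits.AtomisticToContinuum.BoseEinsteinCondensation.Theorems.BECConjugateDominationPuffFloorEulerLagrange
import Summits.AtomisticToContinuum.BoseEinsteinCondensation.Theorems.BECConjugateDominationPuffFloorWeakPairSubsolutionTools

/-!
# Route `BECConjugateDomination`, crux `PuffFloor` (stmt-AtomisticToContinuum-11785),
# line `coupling-slope-pocket`, stub S7a `stub_weakPairSubsolution`: the pair density is a weak subsolution

Supports (does not close) stmt-AtomisticToContinuum-11785; proves the registered stub S7a of skeleton v6
(`Cruxes/PuffFloor/Lines/coupling_slope_pocket.lean`) by name and signature. For the real `C³` exact minimiser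
`Ψ` of `n+2` bosons on the torus of side `L > 2R₀` and every non-negative periodic `C²` test function `f` of the
pair variable, `∫ [(Δf)(x₀−x₁) + (E₀(n+2,L) − E₀(n,L)) f(x₀−x₁)] |Ψ|² ≥ 0`. Steps: the pointwise Euler–Lagrange
equation `ΔΨ = (V − E₀)Ψ` (`Theorems.stub_eulerLagrange`, landed), the half-Laplacian identity
`∫ (Δ_X F)|Ψ|² = 2∫ F(|∇Ψ|² + (V − E₀)|Ψ|²)` for a periodic `C²` weight `F` (`integral_configLaplacian_mul_normSq`:
Green's formula on the torus, product rule, `⟪∂Ψ,Ψ⟫ = ½∂|Ψ|²`, one real integration by parts), the coordinate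
Laplacian of `F(X) = f(x₀−x₁)` (`configLaplacian_pairTest`, tools file) and the slice floor
`∫F(|∇Ψ|² + V|Ψ|²) ≥ E₀(n)∫F|Ψ|²` (`slice_floor_pair_real`, tools file).

References: LSSY2005 Ch. 2 ((2.1)–(2.3), variational principle); Lieb–Seiringer–Yngvason, Phys. Rev. Lett. 94
(2005) / LSSY2005 Lemma C.2 (two-body subsolution precedent); Reed–Simon IV §XIII.12 (eigenvalue equation).
-/

noncomputable section

namespace Summit.AtomisticToContinuum.BoseEinsteinCondensation.Theorems

open MeasureTheory Filter
open scoped ENNReal NNReal BigOperators InnerProductSpace Laplacian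
open Literature.MathematicalPhysics.QuantumManyBody.BoseGas

/-- The coordinate unit vector `e_{i,a}` of `(ℝ³)^N` (particle `i`, axis `a`), local notation. -/
local notation3 "𝐞[" i ", " a "]" => (Pi.single i (EuclideanSpace.single a (1 : ℝ)) : Config _)

namespace PuffFloorWeakPairSubsolution

variable {n : ℕ} {L : ℝ}

/-! ## The weak Euler–Lagrange pairing against `F Ψ` -/

section Pairing

variable {N : ℕ}

/-- **The half-Laplacian identity.** On the torus of side `L > 0`, let `ψ ∈ C²` be periodic and satisfy the
pointwise eigenvalue equation `Δψ = (V − E)ψ` with a continuous real `V` and a real `E`, and let `F ∈ C²` be a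
real periodic weight. Then `∫ (Δ_X F)|ψ|² = 2 ∫ F (|∇ψ|² + (V − E)|ψ|²)`: Green's formula for `⟨∇ψ, ∇(Fψ)⟩`
(`integral_cellN_sum_inner_fderiv_eq`), the product rule, `⟪∂ψ, ψ⟫ = ½∂|ψ|²`, and one real integration by parts
`∫ ∂F ∂|ψ|² = −∫ (∂∂F)|ψ|²` (`integral_cellN_pderiv_eq_zero`). [folklore (ground-state / IMS bookkeeping)] -/
theorem integral_configLaplacian_mul_normSq (hL : 0 < L) {ψ : Config N → ℂ} (hψ2 : ContDiff ℝ 2 ψ)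
    (hψp : IsTorusPeriodic L ψ) {V : Config N → ℝ} (hV : Continuous V) {E : ℝ}
    (hEL : ∀ X, (∑ i : Fin N, ∑ a : Fin 3, fderiv ℝ (fun Y => fderiv ℝ ψ Y 𝐞[i, a]) X 𝐞[i, a]) =
      (((V X - E : ℝ)) : ℂ) * ψ X)
    {F : Config N → ℝ} (hF2 : ContDiff ℝ 2 F) (hFp : IsLatticePeriodic L F) :
    ∫ X in cellN N L, (∑ i : Fin N, ∑ a : Fin 3,
        fderiv ℝ (fun Y => fderiv ℝ F Y 𝐞[i, a]) X 𝐞[i, a]) * ‖ψ X‖ ^ 2 =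
      2 * ∫ X in cellN N L, F X * (kineticDensityReal ψ X + (V X - E) * ‖ψ X‖ ^ 2) := by
  have hψ1 : ContDiff ℝ 1 ψ := hψ2.of_le one_le_two
  have hF1 : ContDiff ℝ 1 F := hF2.of_le one_le_two
  have hψd : ∀ X, DifferentiableAt ℝ ψ X := fun X => hψ1.differentiable one_ne_zero X
  have hFd : ∀ X, DifferentiableAt ℝ F X := fun X => hF1.differentiable one_ne_zero X
  -- the test function `η = F ψ`
  set η : Config N → ℂ := fun X => ((F X : ℝ) : ℂ) * ψ X with hη
  have hη1 : ContDiff ℝ 1 η := (contDiff_ofReal_comp hF1).mul hψ1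
  have hηp : IsTorusPeriodic L η := fun X i k => by simp only [hη, hFp X i k, hψp X i k]
  -- the squared modulus `g = |ψ|²` and its partial derivatives
  set g : Config N → ℝ := fun X => ‖ψ X‖ ^ 2 with hg
  have hg1 : ContDiff ℝ 1 g := hψ1.norm_sq ℝ
  have hgp : IsLatticePeriodic L g := fun X i k => by simp only [hg, hψp X i k]
  have hgderiv : ∀ (X : Config N) (w : Config N), fderiv ℝ g X w = 2 * ⟪ψ X, fderiv ℝ ψ X w⟫_ℝ := by
    intro X w
    rw [((hψd X).hasFDerivAt.norm_sq).fderiv]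
    show (2 • (innerSL ℝ (ψ X)).comp (fderiv ℝ ψ X)) w = _
    rw [two_nsmul]
    show ((innerSL ℝ (ψ X)).comp (fderiv ℝ ψ X)) w + ((innerSL ℝ (ψ X)).comp (fderiv ℝ ψ X)) w = _
    rw [ContinuousLinearMap.comp_apply, innerSL_apply_apply, two_mul]
  -- first and second partial derivatives of `F`, and their continuity
  have hF'1 : ∀ (i : Fin N) (a : Fin 3), ContDiff ℝ 1 (fun X => fderiv ℝ F X 𝐞[i, a]) := fun i a =>
    (hF2.fderiv_right (m := 1) le_rfl).clm_apply contDiff_const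
  have hF'c : ∀ (i : Fin N) (a : Fin 3), Continuous (fun X => fderiv ℝ F X 𝐞[i, a]) := fun i a =>
    (hF'1 i a).continuous
  have hF''c : ∀ (i : Fin N) (a : Fin 3),
      Continuous (fun X => fderiv ℝ (fun Y => fderiv ℝ F Y 𝐞[i, a]) X 𝐞[i, a]) := fun i a =>
    ((hF'1 i a).continuous_fderiv one_ne_zero).clm_apply continuous_const
  have hψ'c : ∀ (i : Fin N) (a : Fin 3), Continuous (fun X => fderiv ℝ ψ X 𝐞[i, a]) := fun i a =>
    (hψ1.continuous_fderiv one_ne_zero).clm_apply continuous_const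
  have hg'c : ∀ (i : Fin N) (a : Fin 3), Continuous (fun X => fderiv ℝ g X 𝐞[i, a]) := fun i a =>
    (hg1.continuous_fderiv one_ne_zero).clm_apply continuous_const
  have hgc : Continuous g := hg1.continuous
  have hFper' : ∀ (w X : Config N) (j : Fin N) (l : Fin 3),
      fderiv ℝ F (X + Pi.single j (EuclideanSpace.single l L)) w = fderiv ℝ F X w := fun w X j l => by
    have hf : (fun Y => F (Y + Pi.single j (EuclideanSpace.single l L))) = F := funext fun Y => hFp Y j l
    rw [← fderiv_comp_add_right, hf]
  -- Green's formula against `η`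
  have green := integral_cellN_sum_inner_fderiv_eq hL hψ2 hη1 hψp hηp
  -- the right-hand side pointwise: `⟪Δψ, Fψ⟫ = (V - E) F |ψ|²`
  have hR : ∀ X, ⟪∑ i : Fin N, ∑ a : Fin 3, fderiv ℝ (fun Y => fderiv ℝ ψ Y 𝐞[i, a]) X 𝐞[i, a], η X⟫_ℝ =
      (V X - E) * F X * ‖ψ X‖ ^ 2 := by
    intro X
    rw [hEL X]
    simp only [hη]
    rw [← Complex.real_smul, ← Complex.real_smul, real_inner_smul_left, real_inner_smul_right,
      real_inner_self_eq_norm_sq]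
    ring
  -- the left-hand side pointwise: `⟪∂ψ, ∂(Fψ)⟫ = F |∂ψ|² + ∂F ⟪∂ψ, ψ⟫ = F|∂ψ|² + ½ ∂F ∂g`
  have hLp : ∀ (X : Config N) (i : Fin N) (a : Fin 3),
      ⟪fderiv ℝ ψ X 𝐞[i, a], fderiv ℝ η X 𝐞[i, a]⟫_ℝ =
        F X * ‖fderiv ℝ ψ X 𝐞[i, a]‖ ^ 2 + 2⁻¹ * (fderiv ℝ F X 𝐞[i, a] * fderiv ℝ g X 𝐞[i, a]) := by
    intro X i a
    have hprod : fderiv ℝ η X 𝐞[i, a] =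
        ((fderiv ℝ F X 𝐞[i, a] : ℝ) : ℂ) * ψ X + ((F X : ℝ) : ℂ) * fderiv ℝ ψ X 𝐞[i, a] := by
      simp only [hη]
      rw [fderiv_mul_apply (differentiableAt_ofReal_comp (hFd X)) (hψd X), fderiv_ofReal_apply (hFd X)]
    rw [hprod, inner_add_right, ← Complex.real_smul, ← Complex.real_smul, real_inner_smul_right,
      real_inner_smul_right, real_inner_self_eq_norm_sq, hgderiv, real_inner_comm]
    ring
  -- integrate the pointwise identities
  have hiK : IntegrableOn (fun X => F X * kineticDensityReal ψ X) (cellN N L) volume :=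
    integrableOn_cellN (hF1.continuous.mul (continuous_kineticDensityReal hψ1)) L
  have hiP : ∀ (i : Fin N) (a : Fin 3),
      IntegrableOn (fun X => fderiv ℝ F X 𝐞[i, a] * fderiv ℝ g X 𝐞[i, a]) (cellN N L) volume :=
    fun i a => integrableOn_cellN ((hF'c i a).mul (hg'c i a)) L
  have hiQ : ∀ (i : Fin N) (a : Fin 3),
      IntegrableOn (fun X => fderiv ℝ (fun Y => fderiv ℝ F Y 𝐞[i, a]) X 𝐞[i, a] * g X) (cellN N L) volume :=
    fun i a => integrableOn_cellN ((hF''c i a).mul hgc) L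
  have hLint : ∫ X in cellN N L, ∑ i : Fin N, ∑ a : Fin 3,
      ⟪fderiv ℝ ψ X 𝐞[i, a], fderiv ℝ η X 𝐞[i, a]⟫_ℝ =
      (∫ X in cellN N L, F X * kineticDensityReal ψ X) +
        2⁻¹ * ∑ i : Fin N, ∑ a : Fin 3, ∫ X in cellN N L, fderiv ℝ F X 𝐞[i, a] * fderiv ℝ g X 𝐞[i, a] := by
    have hpt : ∀ X, (∑ i : Fin N, ∑ a : Fin 3, ⟪fderiv ℝ ψ X 𝐞[i, a], fderiv ℝ η X 𝐞[i, a]⟫_ℝ) =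
        F X * kineticDensityReal ψ X +
          2⁻¹ * ∑ i : Fin N, ∑ a : Fin 3, fderiv ℝ F X 𝐞[i, a] * fderiv ℝ g X 𝐞[i, a] := by
      intro X
      simp_rw [hLp X, Finset.sum_add_distrib, ← Finset.mul_sum]
      rfl
    simp_rw [hpt]
    rw [integral_add hiK, integral_const_mul, integral_finsetSum _ fun i _ =>
      integrable_finsetSum _ fun a _ => hiP i a]
    · congr 1
      congr 1
      exact Finset.sum_congr rfl fun i _ => integral_finsetSum _ fun a _ => hiP i a
    · exact (integrable_finsetSum _ fun i _ => integrable_finsetSum _ fun a _ => hiP i a).const_mul _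
  -- one real integration by parts: `∫ ∂F ∂g = -∫ (∂∂F) g`
  have hIBP : ∀ (i : Fin N) (a : Fin 3),
      ∫ X in cellN N L, fderiv ℝ F X 𝐞[i, a] * fderiv ℝ g X 𝐞[i, a] =
        -∫ X in cellN N L, fderiv ℝ (fun Y => fderiv ℝ F Y 𝐞[i, a]) X 𝐞[i, a] * g X := by
    intro i a
    set P : Config N → ℝ := fun X => fderiv ℝ F X 𝐞[i, a] * g X with hP
    have hP1 : ContDiff ℝ 1 P := (hF'1 i a).mul hg1
    have hPp : IsLatticePeriodic L P := fun X j l => by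
      simp only [hP, hgp X j l, hFper']
    have h0 := integral_cellN_pderiv_eq_zero hL hP1 hPp i a
    have hderiv : ∀ X, pderiv i a P X =
        fderiv ℝ (fun Y => fderiv ℝ F Y 𝐞[i, a]) X 𝐞[i, a] * g X +
          fderiv ℝ F X 𝐞[i, a] * fderiv ℝ g X 𝐞[i, a] := by
      intro X
      simp only [pderiv, hP]
      rw [fderiv_fun_mul ((hF'1 i a).differentiable one_ne_zero X) (hg1.differentiable one_ne_zero X)]
      simp only [FunLike.coe_add, FunLike.coe_smul, Pi.add_apply, Pi.smul_apply, smul_eq_mul]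
      ring
    simp_rw [hderiv] at h0
    rw [integral_add (hiQ i a) (hiP i a)] at h0
    linarith
  -- assemble
  have hRint : ∫ X in cellN N L, ⟪∑ i : Fin N, ∑ a : Fin 3,
      fderiv ℝ (fun Y => fderiv ℝ ψ Y 𝐞[i, a]) X 𝐞[i, a], η X⟫_ℝ =
      ∫ X in cellN N L, (V X - E) * F X * ‖ψ X‖ ^ 2 := integral_congr_ae (Eventually.of_forall hR)
  have hsum : ∑ i : Fin N, ∑ a : Fin 3, ∫ X in cellN N L, fderiv ℝ F X 𝐞[i, a] * fderiv ℝ g X 𝐞[i, a] =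
      -∫ X in cellN N L, (∑ i : Fin N, ∑ a : Fin 3,
        fderiv ℝ (fun Y => fderiv ℝ F Y 𝐞[i, a]) X 𝐞[i, a]) * ‖ψ X‖ ^ 2 := by
    have h3 : ∫ X in cellN N L, ∑ i : Fin N, ∑ a : Fin 3,
        fderiv ℝ (fun Y => fderiv ℝ F Y 𝐞[i, a]) X 𝐞[i, a] * g X =
        ∑ i : Fin N, ∑ a : Fin 3, ∫ X in cellN N L, fderiv ℝ (fun Y => fderiv ℝ F Y 𝐞[i, a]) X 𝐞[i, a] * g X := by
      rw [integral_finsetSum _ (fun i _ => integrable_finsetSum _ (fun a _ => hiQ i a))]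
      exact Finset.sum_congr rfl fun i _ => integral_finsetSum _ fun a _ => hiQ i a
    have h4 : ∫ X in cellN N L, (∑ i : Fin N, ∑ a : Fin 3,
        fderiv ℝ (fun Y => fderiv ℝ F Y 𝐞[i, a]) X 𝐞[i, a]) * ‖ψ X‖ ^ 2 =
        ∫ X in cellN N L, ∑ i : Fin N, ∑ a : Fin 3, fderiv ℝ (fun Y => fderiv ℝ F Y 𝐞[i, a]) X 𝐞[i, a] * g X :=
      integral_congr_ae (Eventually.of_forall fun X => by simp only [Finset.sum_mul, hg])
    simp_rw [hIBP]
    rw [h4, h3]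
    simp only [Finset.sum_neg_distrib]
  have hVint : IntegrableOn (fun X => F X * ((V X - E) * ‖ψ X‖ ^ 2)) (cellN N L) volume :=
    integrableOn_cellN (hF1.continuous.mul ((hV.sub continuous_const).mul (hψ1.continuous.norm.pow 2))) L
  have hVint' : IntegrableOn (fun X => (V X - E) * F X * ‖ψ X‖ ^ 2) (cellN N L) volume :=
    hVint.congr (Eventually.of_forall fun X => by simp only; ring)
  rw [green, hRint, hsum] at hLint
  have hRHS : ∫ X in cellN N L, F X * (kineticDensityReal ψ X + (V X - E) * ‖ψ X‖ ^ 2) =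
      (∫ X in cellN N L, F X * kineticDensityReal ψ X) + ∫ X in cellN N L, (V X - E) * F X * ‖ψ X‖ ^ 2 := by
    have hpt : ∀ X, F X * (kineticDensityReal ψ X + (V X - E) * ‖ψ X‖ ^ 2) =
        F X * kineticDensityReal ψ X + (V X - E) * F X * ‖ψ X‖ ^ 2 := fun X => by ring
    simp_rw [hpt]
    exact integral_add hiK hVint'
  rw [hRHS]
  linarith

end Pairing

end PuffFloorWeakPairSubsolution

open PuffFloorWeakPairSubsolution in
/-- **S7a `stub_weakPairSubsolution` — the pair density of the exact minimiser is a WEAK subsolution.** For a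
smooth finite finite-range `v` (range `R₀`, torus side `L > 2R₀`) and a real `C³` exact minimiser `Ψ` of `n+2`
bosons, every non-negative `Lℤ³`-periodic `C²` test function `f` of the pair variable satisfies
`∫ [(Δf)(x₀−x₁) + (E₀(n+2,L) − E₀(n,L)) f(x₀−x₁)] |Ψ|² ≥ 0`. Proof: with `F(X) = f(x₀−x₁)` (periodic, `C²`,
`Δ_X F = 2(Δf)(x₀−x₁)`, `configLaplacian_pairTest`), the pointwise Euler–Lagrange equation
(`Theorems.stub_eulerLagrange`) and `integral_configLaplacian_mul_normSq` give
`∫ (Δf)(x₀−x₁)|Ψ|² = ∫ F(|∇Ψ|² + (V − E₀(n+2))|Ψ|²)`, and the slice floor `slice_floor_pair_real` bounds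
`∫ F(|∇Ψ|² + V|Ψ|²) ≥ E₀(n)∫F|Ψ|²`. Sources: LSSY2005 Ch. 2 (variational principle, (2.1)–(2.3)); Lieb–Seiringer–
Yngvason 2005 Lemma C.2 (two-body precedent); Reed–Simon IV §XIII.12. -/
theorem stub_weakPairSubsolution :
    ∀ v : ℝ → ℝ≥0∞, IsRepulsiveFiniteRange v → (∀ r, v r ≠ ⊤) →
      ContDiff ℝ 2 (fun x : Space => (v ‖x‖).toReal) →
      ∀ R₀ : ℝ, 0 < R₀ → (∀ r, R₀ < r → v r = 0) →
      ∀ (n : ℕ) (L : ℝ), 0 < L → 2 * R₀ < L → ∀ Ψ : PeriodicTrialState (n + 2) L,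
        periodicEnergy v Ψ = periodicGroundStateEnergy v (n + 2) L → periodicEnergy v Ψ ≠ ⊤ →
        ContDiff ℝ 3 Ψ.ψ → (∀ X, Ψ.ψ X = (‖Ψ.ψ X‖ : ℂ)) →
        ∀ f : Space → ℝ, ContDiff ℝ 2 f → (∀ z, 0 ≤ f z) →
          (∀ (z : Space) (q : Fin 3 → ℤ), f (z + latticeVec L q) = f z) →
          0 ≤ ∫ X in cellN (n + 2) L,
              ((Δ f) (X 0 - X 1) +
                ((periodicGroundStateEnergy v (n + 2) L).toReal -
                  (periodicGroundStateEnergy v n L).toReal) * f (X 0 - X 1)) * ‖Ψ.ψ X‖ ^ 2 := by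
  intro v hv hfin hC2 R₀ hR₀ hrange n L hL h2R Ψ hmin hfinE hC3 _hreal f hf2 hf0 hfper
  set ψ := Ψ.ψ with hψdef
  set V : Config (n + 2) → ℝ := fun X => (periodicInteraction v L X).toReal with hVdef
  set E : ℝ := (periodicGroundStateEnergy v (n + 2) L).toReal with hEdef
  set E' : ℝ := (periodicGroundStateEnergy v n L).toReal with hE'def
  have hW : ∀ X : Config (n + 2), periodicInteraction v L X = ENNReal.ofReal (V X) :=
    periodicInteraction_eq_ofReal_toReal hrange h2R hL hfin
  have hVc : Continuous V :=
    (contDiff_toReal_periodicInteraction hrange h2R hL hfin (hC2.of_le (by norm_num)) (k := 1)).continuous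
  have hV0 : ∀ X, 0 ≤ V X := fun X => ENNReal.toReal_nonneg
  have hψ1 : ContDiff ℝ 1 ψ := Ψ.contDiff
  have hψ2 : ContDiff ℝ 2 ψ := hC3.of_le (by norm_num)
  have hψp : IsTorusPeriodic L ψ := Ψ.periodic
  -- the eigenvalue equation `Δψ = (V - E)ψ`
  have hEL : ∀ X, (∑ i : Fin (n + 2), ∑ a : Fin 3,
      fderiv ℝ (fun Y => fderiv ℝ ψ Y 𝐞[i, a]) X 𝐞[i, a]) = (((V X - E : ℝ)) : ℂ) * ψ X := by
    intro X
    have h := Theorems.stub_eulerLagrange v hv hfin hC2 R₀ hR₀ hrange (n + 1) L hL h2R Ψ hC3 hmin hfinE X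
    push_cast
    linear_combination -h
  -- the test function `F(X) = f(x₀ - x₁)`
  set F : Config (n + 2) → ℝ := fun X => f (X 0 - X 1) with hFdef
  have hF2 : ContDiff ℝ 2 F :=
    hf2.comp (((ContinuousLinearMap.proj (R := ℝ) (φ := fun _ : Fin (n + 2) => Space) 0) -
      (ContinuousLinearMap.proj (R := ℝ) (φ := fun _ : Fin (n + 2) => Space) 1)).contDiff)
  have hfsub : ∀ (z : Space) (k : Fin 3), f (z - EuclideanSpace.single k L) = f z := fun z k => by
    have h := hfper (z - EuclideanSpace.single k L) (Pi.single k 1)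
    rw [latticeVec_single', sub_add_cancel] at h
    exact h.symm
  have hFp : IsLatticePeriodic L F := by
    intro X i k
    simp only [hFdef, Pi.add_apply]
    refine Fin.cases ?_ (fun i' => ?_) i
    · rw [Pi.single_eq_same, Pi.single_eq_of_ne fin_one_ne_zero, add_zero, add_sub_right_comm,
        ← latticeVec_single', hfper]
    · refine Fin.cases ?_ (fun j => ?_) i'
      · simp only [Fin.succ_zero_eq_one]
        rw [Pi.single_eq_same, Pi.single_eq_of_ne fin_one_ne_zero.symm, add_zero, ← sub_sub, hfsub]
      · have h0 : (0 : Fin (n + 2)) ≠ j.succ.succ := (Fin.succ_ne_zero _).symm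
        have h1 : (1 : Fin (n + 2)) ≠ j.succ.succ := by
          rw [show (1 : Fin (n + 2)) = (0 : Fin (n + 1)).succ from rfl, Ne, Fin.succ_inj]
          exact (Fin.succ_ne_zero _).symm
        rw [Pi.single_eq_of_ne h0, Pi.single_eq_of_ne h1, add_zero, add_zero]
  -- the identity
  have hid := integral_configLaplacian_mul_normSq hL hψ2 hψp hVc hEL hF2 hFp
  simp only [hFdef, configLaplacian_pairTest hf2] at hid
  have hid' : ∫ X in cellN (n + 2) L, (Δ f) (X 0 - X 1) * ‖ψ X‖ ^ 2 =
      ∫ X in cellN (n + 2) L, f (X 0 - X 1) * (kineticDensityReal ψ X + (V X - E) * ‖ψ X‖ ^ 2) := by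
    have h2 : ∫ X in cellN (n + 2) L, 2 * (Δ f) (X 0 - X 1) * ‖ψ X‖ ^ 2 =
        2 * ∫ X in cellN (n + 2) L, (Δ f) (X 0 - X 1) * ‖ψ X‖ ^ 2 := by
      rw [← integral_const_mul]
      exact integral_congr_ae (Eventually.of_forall fun X => by ring)
    rw [h2] at hid
    linarith
  -- integrability of the pieces
  have hψc : Continuous ψ := hψ1.continuous
  have hfX : Continuous fun X : Config (n + 2) => f (X 0 - X 1) :=
    hf2.continuous.comp ((continuous_apply 0).sub (continuous_apply 1))
  have hΔc : Continuous fun X : Config (n + 2) => (Δ f) (X 0 - X 1) := by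
    have hc : Continuous (Δ f) := by
      rw [InnerProductSpace.laplacian_eq_iteratedFDeriv_orthonormalBasis f (EuclideanSpace.basisFun (Fin 3) ℝ)]
      exact continuous_finsetSum _ fun a _ =>
        (continuous_eval_const _).comp (hf2.continuous_iteratedFDeriv le_rfl)
    exact hc.comp ((continuous_apply 0).sub (continuous_apply 1))
  have hi1 : IntegrableOn (fun X : Config (n + 2) => (Δ f) (X 0 - X 1) * ‖ψ X‖ ^ 2) (cellN (n + 2) L) volume :=
    integrableOn_cellN (hΔc.mul (hψc.norm.pow 2)) L
  have hi2 : IntegrableOn (fun X : Config (n + 2) => f (X 0 - X 1) * ‖ψ X‖ ^ 2) (cellN (n + 2) L) volume :=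
    integrableOn_cellN (hfX.mul (hψc.norm.pow 2)) L
  have hi3 : IntegrableOn (fun X : Config (n + 2) => f (X 0 - X 1) * kineticDensityReal ψ X)
      (cellN (n + 2) L) volume :=
    integrableOn_cellN (hfX.mul (continuous_kineticDensityReal hψ1)) L
  have hi4 : IntegrableOn (fun X : Config (n + 2) => f (X 0 - X 1) * (V X * ‖ψ X‖ ^ 2)) (cellN (n + 2) L) volume :=
    integrableOn_cellN (hfX.mul (hVc.mul (hψc.norm.pow 2))) L
  -- split the goal integral
  have hgoal : ∫ X in cellN (n + 2) L, ((Δ f) (X 0 - X 1) + (E - E') * f (X 0 - X 1)) * ‖ψ X‖ ^ 2 =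
      (∫ X in cellN (n + 2) L, (Δ f) (X 0 - X 1) * ‖ψ X‖ ^ 2) +
        (E - E') * ∫ X in cellN (n + 2) L, f (X 0 - X 1) * ‖ψ X‖ ^ 2 := by
    rw [← integral_const_mul, ← integral_add hi1 (hi2.const_mul _)]
    exact integral_congr_ae (Eventually.of_forall fun X => by ring)
  have hsplit : ∫ X in cellN (n + 2) L, f (X 0 - X 1) * (kineticDensityReal ψ X + (V X - E) * ‖ψ X‖ ^ 2) =
      (∫ X in cellN (n + 2) L, f (X 0 - X 1) * kineticDensityReal ψ X) +
        (∫ X in cellN (n + 2) L, f (X 0 - X 1) * (V X * ‖ψ X‖ ^ 2)) -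
          E * ∫ X in cellN (n + 2) L, f (X 0 - X 1) * ‖ψ X‖ ^ 2 := by
    have hpt : ∀ X : Config (n + 2), f (X 0 - X 1) * (kineticDensityReal ψ X + (V X - E) * ‖ψ X‖ ^ 2) =
        (f (X 0 - X 1) * kineticDensityReal ψ X + f (X 0 - X 1) * (V X * ‖ψ X‖ ^ 2)) -
          E * (f (X 0 - X 1) * ‖ψ X‖ ^ 2) := fun X => by ring
    have hi34 : IntegrableOn (fun X : Config (n + 2) =>
        f (X 0 - X 1) * kineticDensityReal ψ X + f (X 0 - X 1) * (V X * ‖ψ X‖ ^ 2)) (cellN (n + 2) L) volume :=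
      hi3.add hi4
    have hi2E : IntegrableOn (fun X : Config (n + 2) => E * (f (X 0 - X 1) * ‖ψ X‖ ^ 2)) (cellN (n + 2) L) volume :=
      hi2.const_mul E
    simp_rw [hpt]
    rw [integral_sub hi34 hi2E, integral_add hi3 hi4, integral_const_mul]
  have hsplit' : ∫ X in cellN (n + 2) L, f (X 0 - X 1) * (kineticDensityReal ψ X + V X * ‖ψ X‖ ^ 2) =
      (∫ X in cellN (n + 2) L, f (X 0 - X 1) * kineticDensityReal ψ X) +
        ∫ X in cellN (n + 2) L, f (X 0 - X 1) * (V X * ‖ψ X‖ ^ 2) := by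
    rw [← integral_add hi3 hi4]
    exact integral_congr_ae (Eventually.of_forall fun X => by ring)
  -- the slice floor (trivial if `E₀(n) = ∞`, where `E' = 0`)
  have hfloor : E' * ∫ X in cellN (n + 2) L, f (X 0 - X 1) * ‖ψ X‖ ^ 2 ≤
      (∫ X in cellN (n + 2) L, f (X 0 - X 1) * kineticDensityReal ψ X) +
        ∫ X in cellN (n + 2) L, f (X 0 - X 1) * (V X * ‖ψ X‖ ^ 2) := by
    by_cases hEtop : periodicGroundStateEnergy v n L = ⊤
    · have hE'0 : E' = 0 := by rw [hE'def, hEtop, ENNReal.toReal_top]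
      rw [hE'0, zero_mul]
      exact add_nonneg (integral_nonneg fun X => mul_nonneg (hf0 _) (kineticDensityReal_nonneg _ _))
        (integral_nonneg fun X => mul_nonneg (hf0 _) (mul_nonneg (hV0 X) (sq_nonneg _)))
    · rw [← hsplit']
      exact slice_floor_pair_real hv.1 Ψ hVc hV0 hW hf2.continuous hf0 hEtop
  rw [hgoal, hid', hsplit]
  nlinarith [hfloor]

end Summit.AtomisticToContinuum.BoseEinsteinCondensation.Theorems

end
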